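import Summits.Ventures.HSemireg.FlatTriangleFreeFourCycles
import Mathlib.Tactic
import HarnessLib

/-!
# Venture HSemireg — the flat triangle-free sector is CLOSED for every (d, t): no K-secant design (FLATTF §0 COROLLARY)

Cell `pub-hsemireg`, widening group W5, seat w5-n7-1 (gen 12); files of record `widen/W5/FLATTF-w5n62g17.md` §0
(«COROLLARY … (3∕2) t d² (4d − t) − t d² (7d − 2t) = ½ t d² (t − 2d) > 0 for t > 2d, so ΣN(C₄) ≠ t d² (7d − 2t) for every
flat triangle-free design with t > 2d; at t = 2d the class equation does hold (cube blow-ups) but s² = 9d² > 8d² = 4m, i.e.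
K is REAL — not an admissible cell. Hence: NO flat triangle-free K-secant design exists on four coordinates, for any
margin d and any number of levels t») and `widen/W5/N7-FEASIBILITY-w5n7.md` §3.9 (b) («TRIANGLE-FREE CLASS SYSTEM …
FLAT-μ̄ FAMILY (all margins μ̄, u = m/μ̄ levels): s = −3μ̄, ΣN(C₄) = mμ̄(7μ̄ − 2u), window 2.25μ̄² < m ≤ 3.5μ̄²»; m = u μ̄ tori
per pair, K imaginary quadratic iff s² < 4m). Tree leg imported: `FlatTriangleFreeFourCycles` (`twelve_mul_le`,
`fourCycles_ne_ksecant_value` — the window `2d < t ≤ 7d/2`).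

WHAT THIS LEAF ADDS (one theorem, `no_flat_triangleFree_ksecant`): the SAME hypotheses as the tree's
`fourCycles_ne_ksecant_value` WITHOUT the window `2d < t`, `2t ≤ 7d`, plus the two admissibility facts of a K-secant
cell written in integers — the class equation `ΣN(C₄) = t d² (7d − 2t)` over ℤ (so that `t > 7d/2` is a genuine
negative right-hand side, not a truncated subtraction) and «K imaginary quadratic»: `s² < 4m` with `s = −3d`,
`m = t d`, i.e. `9 d² < 4 t d` — give `False` for every `d ≥ 1` and every `t`. The three ranges: `9d² < 4td` forces
`4t > 9d`, so `t > 2d` (this also disposes of `t = 2d`, where the class equation does hold); for `2t ≤ 7d` the tree's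
corollary applies; for `2t > 7d` the right-hand side is negative and ΣN(C₄) ≥ 0.

HONEST FRAMING: arithmetic on top of the tree's THEOREM L; nothing here is a statement about a variety, a sheaf or a
Hodge class; «K-secant», «cell (m, s)», «admissible» are the notes' names for these integer conditions (N7F §3.6–§3.9).
Nothing in this file says that HC, HC_CM or HC_AV holds; no door ∕ tier ∕ report sentence of the cell is a consequence
of this file alone.
-/

namespace Summit.Ventures.HSemireg.FlatTriangleFreeNoKSecant

open Finset FlatTriangleFreeFourCycles

variable {α β γ δ : Type*} [Fintype α] [Fintype γ] [Fintype δ]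
  [DecidableEq β] [DecidableEq γ] [DecidableEq δ]

/-- **No flat triangle-free K-secant four-coordinate design, for any margin `d ≥ 1` and any number of levels `t`.**
Hypotheses: a flat (d, t) triangle-free design as in `FlatTriangleFreeFourCycles.twelve_mul_le`; the `|S| = 4` class
equation of the triangle-free sector over ℤ, `ΣN(C₄) = t d² (7d − 2t)`; and admissibility of the cell (m, s) = (t d, −3d),
`s² < 4m` i.e. `9 d² < 4 t d`. Conclusion: `False`. -/
theorem no_flat_triangleFree_ksecant (d t : ℕ) (hd : 0 < d)
    (hα : Fintype.card α = t) (hγ : Fintype.card γ = t) (hδ : Fintype.card δ = t)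
    (nAB : α → Finset β) (nAC : α → Finset γ) (nAD : α → Finset δ)
    (nBC : β → Finset γ) (nCB : γ → Finset β) (nBD : β → Finset δ) (nDB : δ → Finset β)
    (nCD : γ → Finset δ) (nDC : δ → Finset γ)
    (cBC : ∀ b c, c ∈ nBC b ↔ b ∈ nCB c) (cBD : ∀ b e, e ∈ nBD b ↔ b ∈ nDB e)
    (cCD : ∀ c e, e ∈ nCD c ↔ c ∈ nDC e)
    (rAB : ∀ a, (nAB a).card = d) (rAC : ∀ a, (nAC a).card = d) (rAD : ∀ a, (nAD a).card = d)
    (rBC : ∀ b, (nBC b).card = d) (rCB : ∀ c, (nCB c).card = d) (rBD : ∀ b, (nBD b).card = d)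
    (rDB : ∀ e, (nDB e).card = d) (rCD : ∀ c, (nCD c).card = d) (rDC : ∀ e, (nDC e).card = d)
    (tABC : ∀ a b c, b ∈ nAB a → c ∈ nBC b → c ∉ nAC a)
    (tABD : ∀ a b e, b ∈ nAB a → e ∈ nBD b → e ∉ nAD a)
    (tACD : ∀ a c e, c ∈ nAC a → e ∈ nCD c → e ∉ nAD a)
    (tBCD : ∀ b c e, c ∈ nBC b → e ∈ nCD c → e ∉ nBD b)
    (hclass : (((∑ a, ∑ b ∈ nAB a, ∑ e ∈ nAD a, (nBC b ∩ nDC e).card) +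
        (∑ a, ∑ b ∈ nAB a, ∑ c ∈ nAC a, (nBD b ∩ nCD c).card) +
        (∑ a, ∑ c ∈ nAC a, ∑ e ∈ nAD a, (nCB c ∩ nDB e).card) : ℕ) : ℤ)
        = (t : ℤ) * (d : ℤ) ^ 2 * (7 * (d : ℤ) - 2 * (t : ℤ)))
    (hadm : 9 * d ^ 2 < 4 * t * d) : False := by
  -- admissibility gives 4t > 9d, so t > 2d
  have h2d : 2 * d < t := by nlinarith
  by_cases h7d : 2 * t ≤ 7 * d
  · -- inside the window: the tree's corollary, after moving the class equation back to ℕ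
    have hne := fourCycles_ne_ksecant_value d t h2d h7d hα hγ hδ nAB nAC nAD nBC nCB nBD nDB nCD nDC cBC cBD cCD
      rAB rAC rAD rBC rCB rBD rDB rCD rDC tABC tABD tACD tBCD
    apply hne
    have hcast : ((t * d ^ 2 * (7 * d - 2 * t) : ℕ) : ℤ) = (t : ℤ) * (d : ℤ) ^ 2 * (7 * (d : ℤ) - 2 * (t : ℤ)) := by
      rw [Nat.cast_mul, Nat.cast_mul, Nat.cast_pow, Nat.cast_sub h7d, Nat.cast_mul, Nat.cast_mul]
      push_cast
      ring
    exact Nat.cast_injective (R := ℤ) (hclass.trans hcast.symm)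
  · -- beyond the window the K-secant value is negative, the count is not
    push Not at h7d
    have ht0 : (0 : ℤ) < (t : ℤ) := by exact_mod_cast (show 0 < t by omega)
    have hd0 : (0 : ℤ) < (d : ℤ) := by exact_mod_cast hd
    have hlt : (7 : ℤ) * (d : ℤ) < 2 * (t : ℤ) := by exact_mod_cast h7d
    have hneg : (t : ℤ) * (d : ℤ) ^ 2 * (7 * (d : ℤ) - 2 * (t : ℤ)) < 0 :=
      mul_neg_of_pos_of_neg (mul_pos ht0 (pow_pos hd0 2)) (by linarith)
    rw [← hclass] at hneg
    exact absurd hneg (not_lt.2 (Nat.cast_nonneg _))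

/-- The arithmetic of the boundary `t = 2d` on its own (FLATTF §0): there the class equation DOES hold for the cube
blow-ups (ΣN = 6d⁴ = t d² (7d − 2t)), and what excludes the cell is exactly admissibility: `9 d² < 4 t d` fails at
`t = 2d` (indeed `4 t d = 8 d² ≤ 9 d²`). -/
theorem not_admissible_two_mul (d : ℕ) : ¬ 9 * d ^ 2 < 4 * (2 * d) * d := by
  intro h; nlinarith

end Summit.Ventures.HSemireg.FlatTriangleFreeNoKSecant
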